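import Mathlib.LinearAlgebra.Matrix.SchurComplement
import Mathlib.LinearAlgebra.Matrix.NonsingularInverse
import Mathlib.Data.Matrix.Block
import HarnessLib

/-!
# Factorisation of the quark determinant by preconditioning and domain decomposition (Lüscher):
# `det D = det A₁₁ · det A₂₂ · det{1 − A₁₁⁻¹A₁₂A₂₂⁻¹A₂₁}`, block-diagonal domain operators, and the
# reduction of the Schur-complement factor to the interface

Topic `LinearAlgebra/Matrix`; sibling of `EvenOddPreconditioning.lean` (the even–odd forms).  PUBLISHED
RESULTS with our proofs, Mathlib-only; no definition, no named fact (D-0026).  Wanted by the cell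
pub-lqcd (venture `LatticeQCDFlow`, HOME/R2-SCOPE.md §3 E2 class D5 "HIERARCHICAL FACTORISED FILTERS:
block determinants and the global Schur complement as successive exact accept/reject factors … exact iff
EVERY factor of det appears in some filter and the last filter is global" — the tree's
`Literature/Probability/MarkovChains/HierarchicalMetropolis.lean` proves the filter chain exact GIVEN a
factorisation `P = ∏ Pᵢ`; this file supplies the factorisation of the fermion determinant that the
printed R2 proposals use, and the algebra behind "the Schur complement acts non-trivially only on the
interface", i.e. what the global filter costs; FANOUT row 38).

## Sources (read on the materialised texts) and what is taken from each

* M. Lüscher, *Schwarz-preconditioned HMC algorithm for two-flavour lattice QCD*, Comput. Phys. Commun.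
  165 (2005) 199 = hep-lat/0409106 [Luscher2005DDHMC] (held text `paper:arxiv-hep-lat_0409106`,
  chunks p0001, p0003):
  > §2.1 Factorization of the quark determinant. In the familiar case of even–odd preconditioning …
  > the (massive) Wilson–Dirac operator … assumes the block form `D = [[A₁₁, A₁₂], [A₂₁, A₂₂]]` (2.1) …
  > Whenever the Dirac operator is written in this way, its determinant may be factorized according to
  > `det D = det A₁₁ det A₂₂ det{1 − A₁₁⁻¹A₁₂A₂₂⁻¹A₂₁}` (2.2), where the operator in the curly bracket
  > is referred to as the preconditioned Dirac operator or (in the mathematical literature) as the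
  > Schur complement … In general, preconditioning is always associated with a factorization
  > `det D = det R₁ … det R_n` (2.3).
  > §3.2 Quark determinant. The factorization `det D = det D_Ω det D_Ω* det{1 − D_Ω⁻¹D_∂Ω D_Ω*⁻¹D_∂Ω*}`
  > (3.2) is now deduced from the block structure (3.1) as in the case of the even–odd preconditioning …
  > The decomposition (3.3) … leads to the identity `det D_Ω = ∏_{all blocks Λ} det D̂_Λ` (3.5) …
  > the operator in the curly bracket … acts non-trivially on only those components of the quark fields
  > that reside on `∂Ω*`. Its determinant can therefore be reduced to the space of all fields supported
  > on this subset of points.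
  (§1: `det_eq_det_mul_det_mul_det_precond` = (2.2); `det_precond_comm` — the two orderings of the
  curly bracket have the same determinant; §2: `det_domain_eq_prod` = (3.5) for a block-diagonal domain
  operator, `det_eq_prod_mul_det_mul_det_schur` = (3.2) with (3.5) inserted, `inv_blockDiagonal` — the
  inverse of the decoupled domain operator is block-diagonal (each domain is solved independently);
  §3: `det_precond_reduce` — if the couplings factor through an interface, `A₁₂ = E F`, the curly
  bracket's determinant is that of an INTERFACE-sized matrix `1 − F A₂₂⁻¹A₂₁A₁₁⁻¹E`.)
* J. Finkenrath, *Tackling critical slowing down using global correction steps with equivariant flows: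
  the case of the Schwinger model*, arXiv:2201.02216 [Finkenrath2022] (held text, chunk p0004):
  > `det D(U) = det 𝒮(U) · ∏ᵢ det D(Uᵢ⁽¹⁾)` with the Schur complement that is defined on the even
  > blocks, `𝒮(U) = 1 − D⁻¹(U⁽¹⁾_{e,e}) D(U⁽¹⁾_{e,o}) D⁻¹(U⁽¹⁾_{o,o}) D(U⁽¹⁾_{o,e})` and the block Dirac
  > operators `D(Uᵢ⁽¹⁾)` defined on a block … the block operators only depend on links within a
  > domain, that means they decouple exactly from each other.
  (`det_eq_prod_mul_prod_mul_det_schurSym` — both colours block-diagonal.)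
* J. Finkenrath, *Review on Algorithms for dynamical fermions*, arXiv:2402.11704 (Lattice 2022 plenary)
  [Finkenrath2024FermionAlgorithms] (held text, chunk p0009):
  > `det D = det S ∏ᵢ det D⁽ᵇˡᵏ⁾ᵢ` with `S = D⁽ᵇˡᵏ⁾_{w,w} − D_{w,b}(D⁽ᵇˡᵏ⁾_{b,b})⁻¹D_{b,w}`, which
  > factorizes the determinant in local part, given by the block determinants, and a global part, given
  > by the Schur compliment `S`. By further decomposing the blocks into smaller blocks, the method
  > becomes recursive.
  (`det_eq_prod_mul_det_schur` — the unsymmetrised form with only the "black" colour block-diagonal.)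

## Scope (honest)

Block algebra over a commutative ring; "domains"/"blocks" are an arbitrary finite index type `o` with
equal-size blocks indexed by `k` (Mathlib's `blockDiagonal : (o → Matrix k k R) → Matrix (k × o) (k × o) R`);
nothing about lattice geometry, Dirichlet boundary conditions, which couplings vanish, the multi-boson
or stochastic treatment of the global factor, or costs.  The recursion "decompose the blocks further" is
the same theorem applied to each `det D̂_Λ` and is not iterated here.  Already in the tree and not
repeated: the one-level predicate-split Schur step `det M = det M_pp · det(M_qq − M_qp M_pp⁻¹ M_pq)` over
`ℂ` (`QuantumLattice/WilsonCellSchur.det_eq_det_toBlock_mul_det_schur`, for the nested dissection of the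
Wilson matrix) and the even–odd forms (`EvenOddPreconditioning.lean`); here: Lüscher's three-factor
form (2.2) with BOTH diagonal blocks inverted, the domain products (3.2)/(3.5) over Mathlib's
`blockDiagonal`, and the interface reduction.

## References

* [Luscher2005DDHMC] M. Lüscher, Comput. Phys. Commun. 165 (2005) 199, §2.1 (2.1)–(2.3), §3.2 (3.2), (3.5).
* [Finkenrath2022] J. Finkenrath, arXiv:2201.02216, p. 4 (recursive Schur decomposition display).
* [Finkenrath2024FermionAlgorithms] J. Finkenrath, arXiv:2402.11704, §"domain decomposition" display
  for `det D = det S ∏ᵢ det D⁽ᵇˡᵏ⁾ᵢ`.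
-/

namespace Literature.LinearAlgebra.Matrix

namespace QuarkDeterminant

open _root_.Matrix

variable {R : Type*} [CommRing R]
variable {m n : Type*} [Fintype m] [Fintype n] [DecidableEq m] [DecidableEq n]

/-! ## §1 Lüscher (2.2): `det D = det A₁₁ · det A₂₂ · det{1 − A₁₁⁻¹ A₁₂ A₂₂⁻¹ A₂₁}` -/

section Precond

/-- **(2.2)**: for invertible diagonal blocks,
`det [[A₁₁, A₁₂], [A₂₁, A₂₂]] = det A₁₁ · det A₂₂ · det(1 − A₁₁⁻¹ A₁₂ A₂₂⁻¹ A₂₁)` — the last factor is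
the determinant of "the preconditioned Dirac operator … the Schur complement".
[cite: Luscher2005DDHMC, §2.1 eq. (2.2)] -/
theorem det_eq_det_mul_det_mul_det_precond (A₁₁ : Matrix m m R) (A₁₂ : Matrix m n R)
    (A₂₁ : Matrix n m R) (A₂₂ : Matrix n n R) (h₁ : IsUnit A₁₁.det) (h₂ : IsUnit A₂₂.det) :
    (fromBlocks A₁₁ A₁₂ A₂₁ A₂₂).det =
      A₁₁.det * A₂₂.det * (1 - A₁₁⁻¹ * A₁₂ * A₂₂⁻¹ * A₂₁).det := by
  letI := A₂₂.invertibleOfIsUnitDet h₂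
  rw [det_fromBlocks₂₂, invOf_eq_nonsing_inv]
  have : A₁₁ - A₁₂ * A₂₂⁻¹ * A₂₁ = A₁₁ * (1 - A₁₁⁻¹ * A₁₂ * A₂₂⁻¹ * A₂₁) := by
    rw [Matrix.mul_sub, Matrix.mul_one]
    simp only [Matrix.mul_assoc]
    rw [← Matrix.mul_assoc A₁₁ A₁₁⁻¹, mul_nonsing_inv _ h₁, Matrix.one_mul]
  rw [this, det_mul]
  ring

/-- The two orderings of the curly bracket have the same determinant:
`det(1 − A₁₁⁻¹A₁₂A₂₂⁻¹A₂₁) = det(1 − A₂₂⁻¹A₂₁A₁₁⁻¹A₁₂)` (Weinstein–Aronszajn) — so (2.2) is symmetric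
under exchanging the roles of the two blocks, and Finkenrath's `𝒮 = 1 − D_ee⁻¹D_eo D_oo⁻¹D_oe` is the same
factor. [cite: Luscher2005DDHMC, §2.1 eq. (2.2)] [cite: Finkenrath2022, p. 4 (𝒮(U) = 1 − D⁻¹_{ee}D_{eo}D⁻¹_{oo}D_{oe})] -/
theorem det_precond_comm (A₁₁ : Matrix m m R) (A₁₂ : Matrix m n R) (A₂₁ : Matrix n m R)
    (A₂₂ : Matrix n n R) :
    (1 - A₁₁⁻¹ * A₁₂ * A₂₂⁻¹ * A₂₁).det = (1 - A₂₂⁻¹ * A₂₁ * A₁₁⁻¹ * A₁₂).det := by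
  rw [show A₁₁⁻¹ * A₁₂ * A₂₂⁻¹ * A₂₁ = (A₁₁⁻¹ * A₁₂) * (A₂₂⁻¹ * A₂₁) by
      simp only [Matrix.mul_assoc], det_one_sub_mul_comm,
    show A₂₂⁻¹ * A₂₁ * (A₁₁⁻¹ * A₁₂) = A₂₂⁻¹ * A₂₁ * A₁₁⁻¹ * A₁₂ by simp only [Matrix.mul_assoc]]

/-- **(2.3) for the two-block case, symmetric form**: `det D = det A₁₁ · det A₂₂ · det 𝒮` with
`𝒮 = 1 − A₂₂⁻¹A₂₁A₁₁⁻¹A₁₂` (the form printed by Finkenrath 2022 with `1 = e`, `2 = o`).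
[cite: Finkenrath2022, p. 4 (det D(U) = det 𝒮(U) · ∏ᵢ det D(Uᵢ⁽¹⁾))] -/
theorem det_eq_det_mul_det_mul_det_schurSym (A₁₁ : Matrix m m R) (A₁₂ : Matrix m n R)
    (A₂₁ : Matrix n m R) (A₂₂ : Matrix n n R) (h₁ : IsUnit A₁₁.det) (h₂ : IsUnit A₂₂.det) :
    (fromBlocks A₁₁ A₁₂ A₂₁ A₂₂).det =
      A₁₁.det * A₂₂.det * (1 - A₂₂⁻¹ * A₂₁ * A₁₁⁻¹ * A₁₂).det := by
  rw [det_eq_det_mul_det_mul_det_precond _ _ _ _ h₁ h₂, det_precond_comm]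

end Precond

/-! ## §2 Domain decomposition: block-diagonal domain operators, (3.2) and (3.5) -/

section Domains

variable {k o : Type*} [Fintype k] [Fintype o] [DecidableEq k] [DecidableEq o]

/-- **(3.5)**: a domain operator that is block-diagonal over the blocks `Λ ∈ o` (the blocks "decouple
exactly from each other") has determinant `∏_Λ det D̂_Λ`. (Mathlib's `det_blockDiagonal`.)
[cite: Luscher2005DDHMC, §3.2 eq. (3.5)] -/
theorem det_domain_eq_prod (B : o → Matrix k k R) : (blockDiagonal B).det = ∏ Λ, (B Λ).det :=
  det_blockDiagonal B

/-- The inverse of a decoupled domain operator is the block-diagonal matrix of the blockwise inverses: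
solving with `D_Ω` means solving each block independently (for invertible blocks).
[cite: Finkenrath2022, p. 4 ("the block operators only depend on links within a domain, that means they decouple exactly")] -/
theorem inv_blockDiagonal (B : o → Matrix k k R) (hB : ∀ Λ, IsUnit (B Λ).det) :
    (blockDiagonal B)⁻¹ = blockDiagonal fun Λ => (B Λ)⁻¹ := by
  refine inv_eq_right_inv ?_
  rw [← blockDiagonal_mul, ← blockDiagonal_one]
  congr 1
  funext Λ
  exact mul_nonsing_inv _ (hB Λ)

/-- A decoupled domain operator with invertible blocks is invertible. [cite: Luscher2005DDHMC, §3.2 eq. (3.5)] -/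
theorem isUnit_det_blockDiagonal (B : o → Matrix k k R) (hB : ∀ Λ, IsUnit (B Λ).det) :
    IsUnit (blockDiagonal B).det := by
  rw [det_blockDiagonal]
  exact IsUnit.prod_univ_iff.mpr hB

/-- **`det D = det S · ∏ᵢ det D⁽ᵇˡᵏ⁾ᵢ`** with `S = D_{w,w} − D_{w,b}(D_{b,b})⁻¹D_{b,w}`: the "white" degrees of
freedom first (index `m`), the "black" ones decoupled into blocks (`D_{b,b} = blockDiagonal B`); the
local part is the product of the block determinants, the global part the Schur complement.
[cite: Finkenrath2024FermionAlgorithms, p. 9 (det D = det S ∏ᵢ det D⁽ᵇˡᵏ⁾ᵢ, S = D_{w,w} − D_{w,b}(D_{b,b})⁻¹D_{b,w})] -/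
theorem det_eq_prod_mul_det_schur (Dww : Matrix m m R) (Dwb : Matrix m (k × o) R)
    (Dbw : Matrix (k × o) m R) (B : o → Matrix k k R) (hB : ∀ Λ, IsUnit (B Λ).det) :
    (fromBlocks Dww Dwb Dbw (blockDiagonal B)).det =
      (∏ Λ, (B Λ).det) * (Dww - Dwb * (blockDiagonal fun Λ => (B Λ)⁻¹) * Dbw).det := by
  letI := (blockDiagonal B).invertibleOfIsUnitDet (isUnit_det_blockDiagonal B hB)
  rw [det_fromBlocks₂₂, invOf_eq_nonsing_inv, inv_blockDiagonal B hB, det_blockDiagonal]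

/-- **(3.2) with (3.5) inserted**: `det D = (∏_Λ det D̂_Λ) · det D_Ω* · det{1 − D_Ω⁻¹D_∂Ω D_Ω*⁻¹D_∂Ω*}`
for a decoupled domain operator `D_Ω = blockDiagonal B` (first block row/column) and an invertible
complementary operator `D_Ω*`. [cite: Luscher2005DDHMC, §3.2 eqs. (3.2), (3.5)] -/
theorem det_eq_prod_mul_det_mul_det_precond (B : o → Matrix k k R) (hB : ∀ Λ, IsUnit (B Λ).det)
    (DdΩ : Matrix (k × o) n R) (DdΩs : Matrix n (k × o) R) (DΩs : Matrix n n R)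
    (hs : IsUnit DΩs.det) :
    (fromBlocks (blockDiagonal B) DdΩ DdΩs DΩs).det =
      (∏ Λ, (B Λ).det) * DΩs.det *
        (1 - (blockDiagonal fun Λ => (B Λ)⁻¹) * DdΩ * DΩs⁻¹ * DdΩs).det := by
  rw [det_eq_det_mul_det_mul_det_precond _ _ _ _ (isUnit_det_blockDiagonal B hB) hs,
    det_blockDiagonal, inv_blockDiagonal B hB]

/-- Both colours decoupled (red–black colouring of blocks): with `D_{e,e} = blockDiagonal Be` and
`D_{o,o} = blockDiagonal Bo`, `det D = (∏ det Be) · (∏ det Bo) · det 𝒮`,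
`𝒮 = 1 − D_ee⁻¹D_eo D_oo⁻¹D_oe` with block-diagonal inverses.
[cite: Finkenrath2022, p. 4 (det D(U) = det 𝒮(U) · ∏ᵢ det D(Uᵢ⁽¹⁾), 𝒮 = 1 − D⁻¹_{ee}D_{eo}D⁻¹_{oo}D_{oe})] -/
theorem det_eq_prod_mul_prod_mul_det_schurSym {k' o' : Type*} [Fintype k'] [Fintype o']
    [DecidableEq k'] [DecidableEq o'] (Be : o → Matrix k k R) (Bo : o' → Matrix k' k' R)
    (hBe : ∀ Λ, IsUnit (Be Λ).det) (hBo : ∀ Λ, IsUnit (Bo Λ).det)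
    (Deo : Matrix (k × o) (k' × o') R) (Doe : Matrix (k' × o') (k × o) R) :
    (fromBlocks (blockDiagonal Be) Deo Doe (blockDiagonal Bo)).det =
      (∏ Λ, (Be Λ).det) * (∏ Λ, (Bo Λ).det) *
        (1 - (blockDiagonal fun Λ => (Be Λ)⁻¹) * Deo * (blockDiagonal fun Λ => (Bo Λ)⁻¹) * Doe).det := by
  rw [det_eq_det_mul_det_mul_det_precond _ _ _ _ (isUnit_det_blockDiagonal Be hBe)
    (isUnit_det_blockDiagonal Bo hBo), det_blockDiagonal, det_blockDiagonal, inv_blockDiagonal Be hBe,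
    inv_blockDiagonal Bo hBo]

end Domains

/-! ## §3 The Schur-complement factor reduces to the interface -/

section Interface

variable {ι : Type*} [Fintype ι] [DecidableEq ι]

/-- **Reduction of the global factor to the interface**: if the coupling `A₁₂` factors through an
interface index set `ι` — `A₁₂ = E F` with `E : m × ι`, `F : ι × n` (only interface components of the
second block are seen from the first) — then
`det(1_m − A₁₁⁻¹ A₁₂ A₂₂⁻¹ A₂₁) = det(1_ι − F A₂₂⁻¹ A₂₁ A₁₁⁻¹ E)`, an `ι × ι` determinant ("the operator
in the curly bracket acts non-trivially on only those components … that reside on `∂Ω*`. Its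
determinant can therefore be reduced to the space of all fields supported on this subset of points").
[cite: Luscher2005DDHMC, §3.2 (reduction of det{…} to the fields supported on ∂Ω*)] -/
theorem det_precond_reduce (A₁₁ : Matrix m m R) (E : Matrix m ι R) (F : Matrix ι n R)
    (A₂₁ : Matrix n m R) (A₂₂ : Matrix n n R) :
    (1 - A₁₁⁻¹ * (E * F) * A₂₂⁻¹ * A₂₁).det = (1 - F * A₂₂⁻¹ * A₂₁ * A₁₁⁻¹ * E).det := by
  rw [show A₁₁⁻¹ * (E * F) * A₂₂⁻¹ * A₂₁ = (A₁₁⁻¹ * E) * (F * A₂₂⁻¹ * A₂₁) by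
      simp only [Matrix.mul_assoc], det_one_sub_mul_comm]
  simp only [Matrix.mul_assoc]

end Interface

end QuarkDeterminant

end Literature.LinearAlgebra.Matrix
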